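import Literature.ModelTheory.ExponentialFields.DefinableClosureElementary
import Literature.ModelTheory.ExponentialFields.Languages
import Mathlib.Algebra.Order.Field.Basic
import HarnessLib

/-!
# `dcl(A) ≼ M` for o-minimal expansions of ordered fields

Topic `Literature/ModelTheory/ExponentialFields`.  The density hypotheses on the definable
closure in `DefinableClosureElementary.lean` (`hmid`, `hgt`, `hlt`, `hne`: points of `M`
definable between two points, above and below a point, and from no parameters) hold in every
expansion of an ordered field `(M; +, *, -, 0, 1, ≤)`: `(a + b)/2 ∈ dcl{a, b}`,
`a + 1, a - 1 ∈ dcl{a}`, `0 ∈ dcl ∅`.  Consequently, for an o-minimal `L`-structure on an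
ordered field `M` with `L` expanding `Language.orderedRing` (`Languages.lean`) compatibly,
every non-empty `A`-definable subset of `M` meets `dcl(A)`, and **`dcl(A)` is an elementary
substructure of `M`** — den Besten 2016, Lemma 4.4.2 / Remark 7.1.4 ("`Dcl(A) ⪯ K`" for the
theories `T_O ⊇ RCF` of expansions of the real field), the form used throughout den Besten
§7.1 and Wilkie 1996, §10 (`k₀ ⪯ Dcl(k₀ ∪ {a}) ⪯ K`).

* `definableClosure_subset_of_expansion`, `midpoint_mem_definableClosure`,
  `add_one_mem_definableClosure`, `sub_one_mem_definableClosure`, `zero_mem_definableClosure`;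
* `exists_mem_definableClosure_of_nonempty_of_orderedField`,
  `isElementary_definableClosureSubstructure_of_orderedField`.

Nothing here is a named fact.

## References

* [DenBesten2016] M. den Besten, *Wilkie's Theorem and the Uniform Real Schanuel Conjecture*,
  MSc thesis, Utrecht 2016, Lemma 4.4.2, Remark 7.1.4.
* [Dries1998] L. van den Dries, *Tame topology and o-minimal structures*, CUP 1998, Ch. 6,
  (1.2)–(1.3) (definable choice and Skolem functions for expansions of ordered groups).
-/

open Set FirstOrder FirstOrder.Language

namespace Literature.ModelTheory.ExponentialFields

variable {L : Language.{0, 0}} {M : Type*} [L.Structure M] [Field M] [LinearOrder M]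
  [IsStrictOrderedRing M]

omit [IsStrictOrderedRing M] in
/-- An expansion does not shrink definable closures: `dcl` computed in `Language.orderedRing`
is contained in `dcl` computed in any compatible expansion `L`. [folklore] -/
theorem definableClosure_subset_of_expansion (φ : Language.orderedRing →ᴸ L)
    [φ.IsExpansionOn M] (A : Set M) :
    definableClosure Language.orderedRing A ⊆ definableClosure L A :=
  fun _ hb => Set.Definable.map_expansion hb φ

/-- `(a + b)/2 ∈ dcl{a, b}` in an expansion of an ordered field: it is the unique `c` with
`c + c = a + b`. [folklore] -/
theorem midpoint_mem_definableClosure (φ : Language.orderedRing →ᴸ L) [φ.IsExpansionOn M]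
    (a b : M) : (a + b) / 2 ∈ definableClosure L ({a, b} : Set M) := by
  refine definableClosure_subset_of_expansion φ _ ?_
  rw [mem_definableClosure_iff, Set.Definable₁, Set.definable_iff_exists_formula_sum]
  let pa : ↥({a, b} : Set M) := ⟨a, by simp⟩
  let pb : ↥({a, b} : Set M) := ⟨b, by simp⟩
  refine ⟨((Term.var (Sum.inr 0) : Language.orderedRing.Term (↥({a, b} : Set M) ⊕ Fin 1)) +
      Term.var (Sum.inr 0)).equal
    ((Term.var (Sum.inl pa) : Language.orderedRing.Term (↥({a, b} : Set M) ⊕ Fin 1)) +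
      Term.var (Sum.inl pb)), ?_⟩
  ext v
  simp only [mem_setOf_eq, mem_singleton_iff, Formula.realize_equal,
    Language.orderedRing.realize_add, Term.realize_var, Sum.elim_inr, Sum.elim_inl]
  show v 0 = (a + b) / 2 ↔ v 0 + v 0 = a + b
  constructor
  · intro h; rw [h]; ring
  · intro h; linarith

omit [IsStrictOrderedRing M] in
/-- `a + 1 ∈ dcl{a}` in an expansion of an ordered field. [folklore] -/
theorem add_one_mem_definableClosure (φ : Language.orderedRing →ᴸ L) [φ.IsExpansionOn M]
    (a : M) : a + 1 ∈ definableClosure L ({a} : Set M) := by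
  refine definableClosure_subset_of_expansion φ _ ?_
  rw [mem_definableClosure_iff, Set.Definable₁, Set.definable_iff_exists_formula_sum]
  refine ⟨(Term.var (Sum.inr 0)).equal (Term.var (Sum.inl ⟨a, rfl⟩) + 1), ?_⟩
  ext v
  simp only [mem_setOf_eq, mem_singleton_iff, Formula.realize_equal,
    Language.orderedRing.realize_add, Language.orderedRing.realize_one, Term.realize_var,
    Sum.elim_inr, Sum.elim_inl]

/-- `a - 1 ∈ dcl{a}` in an expansion of an ordered field. [folklore] -/
theorem sub_one_mem_definableClosure (φ : Language.orderedRing →ᴸ L) [φ.IsExpansionOn M]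
    (a : M) : a - 1 ∈ definableClosure L ({a} : Set M) := by
  refine definableClosure_subset_of_expansion φ _ ?_
  rw [mem_definableClosure_iff, Set.Definable₁, Set.definable_iff_exists_formula_sum]
  refine ⟨((Term.var (Sum.inr 0) : Language.orderedRing.Term (↥({a} : Set M) ⊕ Fin 1)) +
      1).equal (Term.var (Sum.inl ⟨a, rfl⟩)), ?_⟩
  ext v
  simp only [mem_setOf_eq, mem_singleton_iff, Formula.realize_equal,
    Language.orderedRing.realize_add, Language.orderedRing.realize_one, Term.realize_var,
    Sum.elim_inr, Sum.elim_inl]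
  constructor
  · intro h; rw [h]; ring
  · intro h; linarith

omit [IsStrictOrderedRing M] in
/-- `0 ∈ dcl ∅` in an expansion of an ordered field. [folklore] -/
theorem zero_mem_definableClosure (φ : Language.orderedRing →ᴸ L) [φ.IsExpansionOn M] :
    (0 : M) ∈ definableClosure L (∅ : Set M) := by
  refine definableClosure_subset_of_expansion φ _ ?_
  rw [mem_definableClosure_iff, Set.Definable₁, Set.definable_iff_exists_formula_sum]
  refine ⟨(Term.var (Sum.inr 0)).equal 0, ?_⟩
  ext v
  simp only [mem_setOf_eq, mem_singleton_iff, Formula.realize_equal,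
    Language.orderedRing.realize_zero, Term.realize_var, Sum.elim_inr]

omit [IsStrictOrderedRing M] in
/-- The strict order is definable without parameters in an expansion of an ordered field.
[folklore] -/
theorem definable_lt_empty_of_expansion (φ : Language.orderedRing →ᴸ L) [φ.IsExpansionOn M] :
    (∅ : Set M).Definable L {v : Fin 2 → M | v 0 < v 1} :=
  (definable_lt_of_orderedStructure_params (L := Language.orderedRing) (M := M)
    (A := (∅ : Set M))).map_expansion φ

/-- **Every non-empty `A`-definable set meets `dcl(A)`** in an o-minimal expansion of an
ordered field (den Besten 2016, Lemma 4.4.2; van den Dries 1998, Ch. 6, (1.2)–(1.3): definable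
Skolem functions). [cite: DenBesten2016, Lemma 4.4.2] -/
theorem exists_mem_definableClosure_of_nonempty_of_orderedField
    (φ : Language.orderedRing →ᴸ L) [φ.IsExpansionOn M] (hO : L.IsOMinimal M)
    {A : Set M} {S : Set M} (hS : A.Definable₁ L S) (hSne : S.Nonempty) :
    ∃ c ∈ definableClosure L A, c ∈ S :=
  exists_mem_definableClosure_of_nonempty hO (definable_lt_empty_of_expansion φ)
    (fun a b hab => ⟨(a + b) / 2, midpoint_mem_definableClosure φ a b,
      by linarith, by linarith⟩)
    (fun a => ⟨a + 1, add_one_mem_definableClosure φ a, lt_add_one a⟩)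
    (fun a => ⟨a - 1, sub_one_mem_definableClosure φ a, sub_one_lt a⟩)
    ⟨0, zero_mem_definableClosure φ⟩ hS hSne

/-- **`dcl(A) ≼ M` for o-minimal expansions of ordered fields** (den Besten 2016, Lemma 4.4.2
and Remark 7.1.4: "`Dcl(A) ⪯ K`"; van den Dries 1998, Ch. 6, (1.2)–(1.3)): if `M` is an ordered
field, `L` expands `(+, *, -, 0, 1, ≤)` compatibly and `M` is o-minimal as an `L`-structure,
then for every `A ⊆ M` the definable closure `dcl(A)` is an elementary substructure of `M`.
[cite: DenBesten2016, Remark 7.1.4] -/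
theorem isElementary_definableClosureSubstructure_of_orderedField
    (φ : Language.orderedRing →ᴸ L) [φ.IsExpansionOn M] (hO : L.IsOMinimal M) (A : Set M) :
    (definableClosureSubstructure L A).IsElementary :=
  isElementary_definableClosureSubstructure hO (definable_lt_empty_of_expansion φ)
    (fun a b hab => ⟨(a + b) / 2, midpoint_mem_definableClosure φ a b,
      by linarith, by linarith⟩)
    (fun a => ⟨a + 1, add_one_mem_definableClosure φ a, lt_add_one a⟩)
    (fun a => ⟨a - 1, sub_one_mem_definableClosure φ a, sub_one_lt a⟩)
    ⟨0, zero_mem_definableClosure φ⟩ A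

end Literature.ModelTheory.ExponentialFields
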